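import Mathlib
import Summits.QuantumFields.BalabanUV.Beta.AdjointCarrierWiring
import Summits.QuantumFields.BalabanUV.Beta.AveragedContourChainLocal
import Summits.QuantumFields.BalabanUV.Beta.CovariantPlateauBlocks

/-!
# Beta / AdjointCarrierWiringEnd — THE CARRIER WIRING, part 2 (the ENDs): b07∕an4's `M_N(ℂ)`-valued transports
# (tree transport `U(treeWord v)`, the (3.55) chain with averaged legs `U(Γ^{(j)}_{0,v})`, the unit plaquettes `U(∂p)`)
# pushed through the adjoint component map `adMat` of part 1 into the MODEL's real orthogonal `Matrix ι ι ℝ` ∕ `cpxHom`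
# currency of `CovariantPlateauBlocks`, `CoarseCoerciveTransportPair`, `CovariantBoxPoincareBlocks`: (iii) an4's
# `print_transport_defect_local` ⟹ `‖cpx(Rt·Rᵀ) − 1‖ ≤ 2·(C(|v|₁,2)·α + 64d(d+1)²(αL^{2j})∕(L+1))` for `Rt := adMat U(tree)`,
# `R := adMat U(Γ^{(j)}_{0,v})`; (iv) the component transporters `W_b := adMat U_b` on the fibred block carrier are
# orthogonal and `plaqW W = adMat U(∂p)`, so `‖cpx(plaqW W) − 1‖ ≤ 2·‖U(∂p) − 1‖` — the `hplaqW` input of (P)∕(Q)∕PairCurl∕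
# `CovariantBoxPoincareBlocks` with a factor 2 and nothing else (unit `b2b-balaban-beta-d4-p3`, GEN 8, road P3; item
# «MINE (d)» journal l.17529 = the row-D4 owner's residue-(d) OFFER an4-g41 l.17408, spec (iii)–(iv))

HONEST FRAMING: discharging `BetaPertH` makes Bałaban's UV stability UNCONDITIONAL — NOT the continuum limit, NOT the
Clay problem.  HONEST DEPENDENCY (verbatim): «continuum YM on T⁴ ⇐ BetaPertH ∧ nine spine estimates (0/9 proved);
BetaPertH ⇐ (D1) ∧ (D4) ∧ CAP+tail; G-an2-4 gates asym, D1 and NE2/3/4.»  THIS MODULE DISCHARGES NOTHING of `BetaPertH`,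
asserts NOTHING printed and cites nothing as a fact (ABSOLUTE RULE): [folklore] bookkeeping over part 1, pv27
`B9AdOrthogonal`, b07 (`hol`, `hol_mem_of`, `clampCfg`, `avgIter_mem`, `hol_plaqWord_eq`) and an4's KERNEL theorem
`AveragedContourChainLocal.print_transport_defect_local` (all BY NAME); the plaquette bounds ∕ (3.35) stay HYPOTHESES;
[B9] = `Balaban1985BackgroundPropagators` (3.19) p. 393, (3.35) p. 396, (3.55) p. 401 are LOCATORS.  No class change on
row D4 or G-B9-15 (readiness width 0; D4 DISCHARGE NO DATE); NOT BetaPertH, NOT continuum, NOT Clay, NOT summit progress.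

CONTENT (kernel, 0 sorry).  §1 `CompFamily c P e` (the six hypotheses of part 1, bundled; inhabited by su(2)∕Pauli —
`compFamily_pauli`), the orthogonal unit `adUnit`, the group hom **`adHom : U(N)-units →* (Matrix ι ι ℝ)ˣ`** and the
component configuration `adCfg`; **`val_hol_adCfg`**: b07's transport commutes with `adMat` (`hol (adCfg U) = adMat (hol U)`).
§2 (iii) **`norm_cpx_adMat_mul_transpose_sub_one_le`** (`‖cpx(adMat t·(adMat s)ᵀ) − 1‖ ≤ 2‖t·s⁻¹ − 1‖`), `chain_mem_of`
(the chain is `G`-valued when the averaged fields are) and the END **`ad_transport_defect_local`** — an4's local END in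
components.  §3 (iv) on the fibred block carrier of `CovariantPlateauBlocks` (one b07 configuration `U y` per block `y`,
read in block coordinates): `Wad U b := adMat (U_y(emb v, κ))`, **`Wad_transpose_mul_self`**, **`plaqW_Wad`**
(`plaqW (Wad U) = adMat U_y(∂p)`), **`norm_cpx_plaqW_Wad_sub_one_le`** and the `hplaqW`-shaped corollary
**`hplaqW_Wad_of_plaq`** (plaquettes of `U_y` within `α` in the block ⟹ `hplaqW` with `2α`).  §4 non-vacuity (Pauli, flat field).
-/

namespace Summit.QuantumFields.BalabanUV.Beta.AdjointCarrierWiringEnd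

open scoped BigOperators Matrix ComplexOrder Matrix.Norms.L2Operator
open Finset
open Literature.MathematicalPhysics.QuantumFieldTheory.Balaban1983to89 B7Prop1Explicit B7Prop2Explicit B7Prop1Local
open Literature.MathematicalPhysics.QuantumFieldTheory.Balaban1983to89.B9AdOrthogonal
open Literature.MathematicalPhysics.QuantumLattice (isUnit_det_of_mem_unitaryGroup)
open Summit.QuantumFields.BalabanUV.Beta.ThinLoopHolonomy (cpxHom hol_map)
open Summit.QuantumFields.BalabanUV.Beta.AdjointCarrierWiring
open Summit.QuantumFields.BalabanUV.Beta.AveragedBondUnrolling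
open Summit.QuantumFields.BalabanUV.Beta.AveragedContourChain
open Summit.QuantumFields.BalabanUV.Beta.AveragedContourChainLocal
open Summit.QuantumFields.BalabanUV.Beta.CovariantPlateauBlocks (Off BSite Bond emb succOff emb_succOff plaqW)

noncomputable section

variable {n : Type} [Fintype n] [DecidableEq n] {ι : Type} [Fintype ι] [DecidableEq ι]

/-! ## §1 Component families, the hom `adHom`, and transport in components -/

/-- **A trace-orthonormal hermitian component family** (the six [folklore] hypotheses of part 1, bundled as DATA — a
parametrised record, NOT a named fact): `c > 0`, `P` a real subspace of hermitian matrices stable under `R(U(N))`,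
`e : ι → P` `form c`-orthonormal and complete on `P` — e.g. u(N) or su(N) with pv27's Gell-Mann families
(`exists_orthonormal_complete`), su(2) with the Pauli matrices (`compFamily_pauli` below). [folklore] -/
structure CompFamily (c : ℝ) (P : Submodule ℝ (Matrix n n ℂ)) (e : ι → Matrix n n ℂ) : Type where
  pos : 0 < c
  herm : ∀ X ∈ P, X.IsHermitian
  mem : ∀ k, e k ∈ P
  orth : ∀ k l, form c (e k) (e l) = if k = l then (1 : ℝ) else 0
  compl : ∀ X ∈ P, ∑ k, form c (e k) X • e k = X
  stable : ∀ u ∈ Matrix.unitaryGroup n ℂ, ∀ X ∈ P, R u X ∈ P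

/-- su(2) in the Pauli components is a component family (pv27 §4 BY NAME). [folklore] -/
def compFamily_pauli : CompFamily (1 / 2 : ℝ) (herm0 (Fin 2)) pauli :=
  ⟨by norm_num, fun _ hX => hX.1, fun k => ⟨pauli_isHermitian k, pauli_trace k⟩, pauli_orth,
    fun X hX => pauli_complete X hX.1 hX.2, fun _ hu _ hX => R_mem_herm0 hu hX⟩

variable {c : ℝ} {P : Submodule ℝ (Matrix n n ℂ)} {e : ι → Matrix n n ℂ} (hF : CompFamily c P e)

/-- The component matrix of a unitary as an ORTHOGONAL UNIT of `Matrix ι ι ℝ` (inverse = transpose). [folklore] -/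
def adUnit (u : Matrix n n ℂ) (hu : u ∈ Matrix.unitaryGroup n ℂ) : (Matrix ι ι ℝ)ˣ :=
  ⟨adMat c e u, (adMat c e u)ᵀ, adMat_mul_transpose_self c P e hF.mem hF.compl hF.stable hF.orth hu,
    adMat_transpose_mul_self c P e hF.mem hF.compl hF.stable hF.orth hu⟩

/-- `↑(adUnit u) = adMat u`. [folklore] -/
@[simp] theorem val_adUnit (u : Matrix n n ℂ) (hu : u ∈ Matrix.unitaryGroup n ℂ) :
    ((adUnit hF u hu : (Matrix ι ι ℝ)ˣ) : Matrix ι ι ℝ) = adMat c e u := rfl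

/-- **THE ADJOINT COMPONENT HOM** `U(N)-valued units of M_N(ℂ) →* (Matrix ι ι ℝ)ˣ` (b07's gauge group `unitaryUnits`).
[cite: Balaban1985BackgroundPropagators, (3.19) p.393] -/
def adHom : unitaryUnits (Matrix n n ℂ) →* (Matrix ι ι ℝ)ˣ where
  toFun g := adUnit hF (g.1 : Matrix n n ℂ) (mem_unitaryUnits.mp g.2)
  map_one' := Units.ext (by
    simp only [val_adUnit, OneMemClass.coe_one, Units.val_one]
    exact adMat_one c e hF.orth)
  map_mul' g h := Units.ext (by
    simp only [val_adUnit, Subgroup.coe_mul, Units.val_mul]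
    exact adMat_mul c P e hF.mem hF.compl hF.stable _ (mem_unitaryUnits.mp h.2))

/-- `↑(adHom g) = adMat ↑g`. [folklore] -/
@[simp] theorem val_adHom (g : unitaryUnits (Matrix n n ℂ)) :
    ((adHom hF g : (Matrix ι ι ℝ)ˣ) : Matrix ι ι ℝ) = adMat c e ((g : (Matrix n n ℂ)ˣ) : Matrix n n ℂ) := rfl

variable {d : ℕ}

/-- **THE COMPONENT CONFIGURATION** of a `U(N)`-valued b07 configuration: `(adCfg U)(x, κ) = adMat U(x, κ)` as
orthogonal units. [folklore] -/
def adCfg (V : Site d → Fin d → (Matrix n n ℂ)ˣ) (hV : ∀ x κ, V x κ ∈ unitaryUnits (Matrix n n ℂ)) :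
    Site d → Fin d → (Matrix ι ι ℝ)ˣ :=
  fun x κ => adHom hF ⟨V x κ, hV x κ⟩

/-- **TRANSPORT COMMUTES WITH `adMat`**: `↑(hol (adCfg U) x w) = adMat ↑(hol U x w)` for every lattice word (b07's `hol` is
a product of bond variables and their inverses; `adHom` is a group hom — `hol_map` BY NAME).
[cite: Balaban1985BackgroundPropagators, (3.19) p.393] -/
theorem val_hol_adCfg (V : Site d → Fin d → (Matrix n n ℂ)ˣ) (hV : ∀ x κ, V x κ ∈ unitaryUnits (Matrix n n ℂ))
    (x : Site d) (w : List (Letter d)) :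
    ((hol (adCfg hF V hV) x w : (Matrix ι ι ℝ)ˣ) : Matrix ι ι ℝ) =
      adMat c e ((hol V x w : (Matrix n n ℂ)ˣ) : Matrix n n ℂ) := by
  set V' : Site d → Fin d → unitaryUnits (Matrix n n ℂ) := fun x κ => ⟨V x κ, hV x κ⟩ with hV'
  have h1 : hol (adCfg hF V hV) x w = adHom hF (hol V' x w) := hol_map (adHom hF) V' x w
  have h2 : hol V x w = ((hol V' x w : unitaryUnits (Matrix n n ℂ)) : (Matrix n n ℂ)ˣ) :=
    hol_map (unitaryUnits (Matrix n n ℂ)).subtype V' x w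
  rw [h1, val_adHom, h2]

/-- Transports of a `unitaryUnits`-valued configuration are unitary matrices. [folklore] -/
theorem val_hol_mem_unitaryGroup (V : Site d → Fin d → (Matrix n n ℂ)ˣ)
    (hV : ∀ x κ, V x κ ∈ unitaryUnits (Matrix n n ℂ)) (x : Site d) (w : List (Letter d)) :
    ((hol V x w : (Matrix n n ℂ)ˣ) : Matrix n n ℂ) ∈ Matrix.unitaryGroup n ℂ :=
  mem_unitaryUnits.mp (hol_mem_of hV x w)

/-! ## §2 (iii) The tree and chain transports in components -/

include hF in
/-- **TWO TRANSPORTS IN COMPONENTS**: for unitary `t, s`, `‖cpx(adMat t · (adMat s)ᵀ) − 1‖ ≤ 2·‖t·s⁻¹ − 1‖`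
(`(adMat s)ᵀ = adMat s⁻¹`, multiplicativity, part 1's Lipschitz bound). [folklore] -/
theorem norm_cpx_adMat_mul_transpose_sub_one_le {t s : Matrix n n ℂ} (ht : t ∈ Matrix.unitaryGroup n ℂ)
    (hs : s ∈ Matrix.unitaryGroup n ℂ) :
    ‖cpxHom (adMat c e t * (adMat c e s)ᵀ) - 1‖ ≤ 2 * ‖t * s⁻¹ - 1‖ := by
  have hs' : s⁻¹ ∈ Matrix.unitaryGroup n ℂ := inv_mem_of_mem hs
  rw [← adMat_inv c e (isUnit_det_of_mem_unitaryGroup hs), ← adMat_mul c P e hF.mem hF.compl hF.stable t hs']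
  exact norm_cpx_adMat_sub_one_le hF.pos P hF.herm e hF.mem hF.orth hF.compl hF.stable (Submonoid.mul_mem _ ht hs')

section Chain

variable {𝔸 : Type*} [NormedRing 𝔸] [NormOneClass 𝔸] [NormedAlgebra ℂ 𝔸] [CompleteSpace 𝔸]

omit [NormOneClass 𝔸] in
/-- The (3.55) chain is `G`-valued as soon as the averaged fields `Ū^l`, `l < j`, are. [folklore] -/
theorem chain_mem_of (L : ℕ) {G : Subgroup 𝔸ˣ} {V : Site d → Fin d → 𝔸ˣ} :
    ∀ j : ℕ, (∀ l < j, ∀ x κ, avgIter L V l x κ ∈ G) → ∀ v : Fin d → ℕ, chain L V j v ∈ G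
  | 0, _, _ => by rw [chain_zero]; exact G.one_mem
  | j + 1, hU, v => by
    rw [chain_succ]
    exact G.mul_mem (hol_mem_of (hU j (Nat.lt_succ_self j)) _ _) (chain_mem_of L j (fun l hl => hU l (by omega)) v)

end Chain

/-- **THE CARRIER WIRING OF an4's LOCAL END.**  `N ≥ 1` colours, a component family `(c, P, e)`, an `AvgClosed` gauge
group `G` of UNITARY units of `M_N(ℂ)` (e.g. `U(N)` itself, b07 `avgClosed_unitaryUnits`), a `G`-valued configuration
`U` whose unit plaquettes INSIDE the `j`-block are within `α` of `1`, b07's smallness at the levels `m < j`: with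
`Rt := adMat U(treeWord v)` and `R := adMat U(Γ^{(j)}_{0,v})` (real orthogonal),
`‖cpx(Rt·Rᵀ) − 1‖ ≤ 2·(C(|v|₁,2)·α + 64d(d+1)²·(αL^{2j})∕(L+1))` — `print_transport_defect_local` BY NAME, factor 2 from
part 1. [cite: Balaban1985BackgroundPropagators, (3.19) p.393, (3.35) p.396, (3.55) p.401] -/
theorem ad_transport_defect_local (hF : CompFamily c P e) [Nonempty n] (L : ℕ) (hL : 2 ≤ L) {G : Subgroup (Matrix n n ℂ)ˣ}
    (hG : AvgClosed d L G) (hGu : G ≤ unitaryUnits (Matrix n n ℂ)) (V : Site d → Fin d → (Matrix n n ℂ)ˣ)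
    (hVG : ∀ x κ, V x κ ∈ G) {α : ℝ} (hα : 0 < α) (j : ℕ) (h52 : pdevOn 0 (boxTop L j) V < α)
    (hreg : ∀ m < j, C0 d * (α * ((L : ℝ) ^ m) ^ 2) ≤ 1 / 3 ∧ 2 * (α * ((L : ℝ) ^ m) ^ 2) ≤ c2' d L)
    (hlog : ∀ m < j, (2 * ((d : ℝ) + 1) * L) ^ 2 * (2 * (α * ((L : ℝ) ^ m) ^ 2)) ≤ 1 / 2)
    (v : Fin d → ℕ) (hv : ∀ i, v i < L ^ j) :
    ‖cpxHom (adMat c e ((hol V 0 (treeWord (natVec v)) : (Matrix n n ℂ)ˣ) : Matrix n n ℂ) *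
        (adMat c e ((chain L V j v : (Matrix n n ℂ)ˣ) : Matrix n n ℂ))ᵀ) - 1‖ ≤
      2 * (((l1 (natVec v)).choose 2 : ℕ) * α +
        64 * d * ((d : ℝ) + 1) ^ 2 * (α * ((L : ℝ) ^ j) ^ 2) / ((L : ℝ) + 1)) := by
  have hVu : ∀ x κ, V x κ ∈ unitaryUnits (Matrix n n ℂ) := fun x κ => hGu (hVG x κ)
  -- the tree transport is unitary
  have ht : ((hol V 0 (treeWord (natVec v)) : (Matrix n n ℂ)ˣ) : Matrix n n ℂ) ∈ Matrix.unitaryGroup n ℂ :=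
    val_hol_mem_unitaryGroup V hVu 0 _
  -- the chain is `G`-valued: clamp outside the block, b07's `avgIter_mem` on the clamped field, transfer by locality
  have hL1 : 1 ≤ L := le_trans (by norm_num) hL
  have hlohi : ∀ i, (0 : Site d) i ≤ boxTop L j i := fun i => by
    simp only [Pi.zero_apply, boxTop, sub_nonneg]
    exact_mod_cast Nat.one_le_pow j L hL1
  set V' : Site d → Fin d → (Matrix n n ℂ)ˣ := clampCfg 0 (boxTop L j) V with hV'
  have hV'G : ∀ x κ, V' x κ ∈ G := clampCfg_mem hVG
  have h52' : pdev V' < α := (pdev_clampCfg_le hlohi fun x κ => hG.le_U1 (hVG x κ)).trans_lt h52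
  have havg : ∀ m < j, ∀ x κ, avgIter L V' m x κ ∈ G := by
    intro m hm
    have hα₀ : 0 < α * ((L : ℝ) ^ m) ^ 2 := by positivity
    have h52'' : pdev V' < α * ((L : ℝ) ^ m) ^ 2 * ((((L : ℝ) ^ m)⁻¹) ^ 2) := by
      rwa [mul_assoc, ← mul_pow, mul_inv_cancel₀ (by positivity), one_pow, mul_one]
    exact avgIter_mem L hL hG m V' hV'G hα₀ (hreg m hm).1 (hreg m hm).2 h52'' m le_rfl
  have hchain : chain L V j v ∈ G := by
    rw [← chain_congr L hL1 (clampCfg_agree V) v hv j le_rfl]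
    exact chain_mem_of L j havg v
  have hs : ((chain L V j v : (Matrix n n ℂ)ˣ) : Matrix n n ℂ) ∈ Matrix.unitaryGroup n ℂ :=
    mem_unitaryUnits.mp (hGu hchain)
  -- assemble
  have hEND := print_transport_defect_local L hL hG V hVG hα j h52 hreg hlog v hv
  refine (norm_cpx_adMat_mul_transpose_sub_one_le hF ht hs).trans ?_
  rw [← Matrix.coe_units_inv, ← Units.val_mul]
  linarith

/-! ## §3 (iv) The component transporters on the fibred block carrier and their plaquettes -/

section Blocks

variable {Y : Type} {ν m : ℕ} (U : Y → Site ν → Fin ν → (Matrix n n ℂ)ˣ)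
  (hU : ∀ y x κ, U y x κ ∈ unitaryUnits (Matrix n n ℂ))

/-- **THE MODEL'S FINE TRANSPORTERS**: on the fibred block carrier (`CovariantPlateauBlocks`: blocks `Y` × offsets
`(Fin m)^ν`), one b07 configuration `U_y` per block read in block coordinates, `W_b := adMat U_y(emb v, κ)` for the bond
`b = ((y, v), κ)`. [cite: Balaban1985BackgroundPropagators, (3.19) p.393] -/
def Wad (b : Bond Y ν m) : Matrix ι ι ℝ := adMat c e ((U b.1.1 (emb b.1.2) b.2 : (Matrix n n ℂ)ˣ) : Matrix n n ℂ)

omit [Fintype ι] [DecidableEq ι] in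
/-- Unfolding equation. [folklore] -/
theorem Wad_apply (b : Bond Y ν m) :
    Wad (c := c) (e := e) U b = adMat c e ((U b.1.1 (emb b.1.2) b.2 : (Matrix n n ℂ)ˣ) : Matrix n n ℂ) := rfl

include hF hU in
/-- **ORTHOGONALITY** `(W_b)ᵀ·W_b = 1` — the hypothesis `hW` of (P)∕(Q)∕PairCurl∕`CovariantBoxPoincareBlocks`. [folklore] -/
theorem Wad_transpose_mul_self (b : Bond Y ν m) : (Wad (c := c) (e := e) U b)ᵀ * Wad (c := c) (e := e) U b = 1 :=
  adMat_transpose_mul_self c P e hF.mem hF.compl hF.stable hF.orth (mem_unitaryUnits.mp (hU _ _ _))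

include hF hU in
/-- **THE IN-BLOCK PLAQUETTE OF `W` IS `adMat` OF THE PLAQUETTE OF `U`**: `plaqW W y v κ μ = adMat U_y(∂p)`,
`p = (emb v; κ, μ)` (b07 `hol_plaqWord_eq`, `emb_succOff`, multiplicativity and `adMat u⁻¹ = (adMat u)ᵀ`).
[cite: Balaban1985Averaging, (44) p.24] -/
theorem plaqW_Wad (y : Y) (v : Off ν m) (κ μ : Fin ν) (hκ : (v κ : ℕ) + 1 < m) (hμ : (v μ : ℕ) + 1 < m) :
    plaqW (Wad (c := c) (e := e) U) y v κ μ hκ hμ =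
      adMat c e ((hol (U y) (emb v) (plaqWord κ μ) : (Matrix n n ℂ)ˣ) : Matrix n n ℂ) := by
  rw [← val_hol_adCfg hF (U y) (hU y), hol_plaqWord_eq]
  simp only [plaqW, Wad_apply, Units.val_mul, emb_succOff]
  rfl

include hF hU in
/-- **PLAQUETTES IN COMPONENTS COST A FACTOR 2**: `‖cpx(plaqW W y v κ μ) − 1‖ ≤ 2·‖U_y(∂p) − 1‖`.
[cite: Balaban1985BackgroundPropagators, (3.35) p.396] -/
theorem norm_cpx_plaqW_Wad_sub_one_le (y : Y) (v : Off ν m) (κ μ : Fin ν) (hκ : (v κ : ℕ) + 1 < m)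
    (hμ : (v μ : ℕ) + 1 < m) :
    ‖cpxHom (plaqW (Wad (c := c) (e := e) U) y v κ μ hκ hμ) - 1‖ ≤
      2 * ‖((hol (U y) (emb v) (plaqWord κ μ) : (Matrix n n ℂ)ˣ) : Matrix n n ℂ) - 1‖ := by
  rw [plaqW_Wad hF U hU]
  exact norm_cpx_adMat_sub_one_le hF.pos P hF.herm e hF.mem hF.orth hF.compl hF.stable
    (val_hol_mem_unitaryGroup (U y) (hU y) _ _)

include hF hU in
/-- **THE `hplaqW` INPUT OF THE MODEL FROM A PLAQUETTE BOUND ON `U`**: if every unit plaquette of `U_y` based at a block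
offset with both successors inside the block is within `α` of `1` (operator norm), then the component transporters satisfy
the plaquette hypothesis of `CovariantPlateauBlocks.hdef_le_of_plaqW` ∕ `CovariantBoxPoincareBlocks.covariant_box_poincare_
blocks_of_plaqW` with `2α`. [cite: Balaban1985BackgroundPropagators, (3.35) p.396] -/
theorem hplaqW_Wad_of_plaq {α : ℝ}
    (hplaq : ∀ (y : Y) (v : Off ν m) (κ μ : Fin ν), (v κ : ℕ) + 1 < m → (v μ : ℕ) + 1 < m → κ ≠ μ →
      ‖((hol (U y) (emb v) (plaqWord κ μ) : (Matrix n n ℂ)ˣ) : Matrix n n ℂ) - 1‖ ≤ α)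
    (y : Y) (v : Off ν m) (κ μ : Fin ν) (hκ : (v κ : ℕ) + 1 < m) (hμ : (v μ : ℕ) + 1 < m) (hκμ : κ ≠ μ) :
    ‖cpxHom (plaqW (Wad (c := c) (e := e) U) y v κ μ hκ hμ) - 1‖ ≤ 2 * α :=
  (norm_cpx_plaqW_Wad_sub_one_le hF U hU y v κ μ hκ hμ).trans (by linarith [hplaq y v κ μ hκ hμ hκμ])

end Blocks

/-! ## §4 Non-vacuity -/

/-- Flat-field transport is trivial (every bond variable `1`). [folklore] -/
theorem hol_flat {G : Type*} [Group G] : ∀ (x : Site d) (w : List (Letter d)), hol (fun _ _ => (1 : G)) x w = 1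
  | x, [] => rfl
  | x, l :: w => by
    rw [hol_cons, hol_flat (x + l.vec) w, mul_one]
    unfold stepHol
    split <;> simp

/-- su(2) in the Pauli components, one block, the flat `U(2)`-field: the plaquette input holds with `α = 0`, so §3 gives
`hplaqW` with `2·0` — every hypothesis (`CompFamily`, `unitaryUnits`-valuedness) is discharged. [folklore] -/
example (v : Off 2 3) (κ μ : Fin 2) (hκ : (v κ : ℕ) + 1 < 3) (hμ : (v μ : ℕ) + 1 < 3) (hκμ : κ ≠ μ) :
    ‖cpxHom (plaqW (Wad (c := (1 / 2 : ℝ)) (e := pauli)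
        (fun (_ : Unit) (_ : Site 2) (_ : Fin 2) => (1 : (Matrix (Fin 2) (Fin 2) ℂ)ˣ))) () v κ μ hκ hμ) - 1‖ ≤ 2 * 0 :=
  hplaqW_Wad_of_plaq compFamily_pauli _ (fun _ _ _ => (unitaryUnits _).one_mem)
    (fun y v κ μ _ _ _ => by rw [hol_flat]; simp) () v κ μ hκ hμ hκμ

end

end Summit.QuantumFields.BalabanUV.Beta.AdjointCarrierWiringEnd
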